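import Mathlib
import Literature.Computability.Complexity.BoolEncodings
import Literature.NumberTheory.LFunctions.MoebiusWalshCircuitsProofs
import HarnessLib

/-!
# Stub stub_coprimePairs_lower (line Sketch, crux CircuitNpAcc0, separable rung R-A)

Non-degeneracy of the Jacobi level-set character `χ₂ x = (N(u) | 2 N(v) + 1)`, `u` = the first
`⌊n/2⌋` bits of the word `List.ofFn x`, `v` = the remaining `⌈n/2⌉` bits, both read little-endian by
`bitsToNat`: eventually `#{x : Fin n → Bool | χ₂ x ≠ 0} ≥ 2ⁿ / (4 n)`.

Proof. `x ↦ N(List.ofFn x)` is a bijection of `Fin n → Bool` with `[0, 2ⁿ)` (injectivity is the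
tree's `MoebiusWalsh.bitsToNat_ofFn_injective`) under which
`(N(u), N(v)) = (N mod 2^h, N / 2^h)`, `h = ⌊n/2⌋` (`coprimePairs_card_eq`). Pairs `(a, p)` with `p` an
odd prime `≤ 2^{h'+1}` (`h' = n - h`) not dividing `a < 2^h` inject into the good set via
`(a, p) ↦ a + 2^h ⌊p/2⌋` (`jacobiSym.ne_zero`); for each such `p` there are `≥ 2^h - ⌊2^h/3⌋ - 1`
values of `a` (`coprimePairs_good_le`), and the number of primes `≤ 2^k` is `≥ (2^k - k - 1)/k` by the
elementary Chebyshev bound `2^N ≤ (N+1) lcm(1..N) ≤ (N+1) N^{π(N)}` of Mathlib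
(`Chebyshev.two_pow_le_mul_lcmUpto`, `Nat.lcmUpto_eq_prod_pow_log`; `coprimePairs_primesLE_two_pow`).
Elementary arithmetic finishes for `n ≥ 8`. Theorems only; sorry-free.
-/

set_option linter.dupNamespace false -- `Summit.PneNP.PneNP.…`: summit = sub-problem (D-0017)

namespace Summit.PneNP.PneNP.Theorems.CircuitNpAcc0

open Finset Literature.Computability.Complexity

open Literature.NumberTheory.LFunctions.MoebiusWalsh (bitsToNat_ofFn_injective)

/-- The values `N(List.ofFn x)`, `x : Fin n → Bool`, are exactly `[0, 2ⁿ)`. [folklore] -/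
theorem coprimePairs_image_val (n : ℕ) :
    (univ : Finset (Fin n → Bool)).image (fun x => bitsToNat (List.ofFn x)) = range (2 ^ n) := by
  apply Finset.eq_of_subset_of_card_le
  · intro N hN
    obtain ⟨x, -, rfl⟩ := Finset.mem_image.1 hN
    simpa using bitsToNat_lt (List.ofFn x)
  · rw [Finset.card_image_of_injective _ (bitsToNat_ofFn_injective n), card_range]
    simp

/-- Splitting a word at `h`: the low part has value `N mod 2^h`, the high part `N / 2^h`. [folklore] -/
theorem coprimePairs_take_drop (l : List Bool) {h : ℕ} (hh : h ≤ l.length) :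
    bitsToNat (l.take h) = bitsToNat l % 2 ^ h ∧ bitsToNat (l.drop h) = bitsToNat l / 2 ^ h := by
  have happ := bitsToNat_append (l.take h) (l.drop h)
  rw [List.take_append_drop, List.length_take, min_eq_left hh] at happ
  have hlt : bitsToNat (l.take h) < 2 ^ h := by
    have := bitsToNat_lt (l.take h)
    rwa [List.length_take, min_eq_left hh] at this
  have hpos : 0 < 2 ^ h := by positivity
  constructor
  · rw [happ, Nat.add_mul_mod_self_left, Nat.mod_eq_of_lt hlt]
  · rw [happ, Nat.add_mul_div_left _ _ hpos, Nat.div_eq_of_lt hlt, zero_add]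

/-- Transfer of the count of words with `χ₂ ≠ 0` to a count over `[0, 2ⁿ)`. [folklore] -/
theorem coprimePairs_card_eq (n : ℕ) :
    (univ.filter fun x : Fin n → Bool =>
      jacobiSym (↑(bitsToNat ((List.ofFn x).take ((List.ofFn x).length / 2))))
        (2 * bitsToNat ((List.ofFn x).drop ((List.ofFn x).length / 2)) + 1) ≠ 0).card =
    ((range (2 ^ n)).filter fun N : ℕ =>
      jacobiSym ((N % 2 ^ (n / 2) : ℕ) : ℤ) (2 * (N / 2 ^ (n / 2)) + 1) ≠ 0).card := by
  refine Finset.card_nbij (fun x : Fin n → Bool => bitsToNat (List.ofFn x)) ?_ ?_ ?_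
  · intro x hx
    rw [Finset.mem_coe, Finset.mem_filter] at hx
    have hlen : (List.ofFn x).length = n := List.length_ofFn ..
    obtain ⟨ht, hd⟩ := coprimePairs_take_drop (List.ofFn x) (h := n / 2)
      (by rw [hlen]; exact Nat.div_le_self n 2)
    rw [hlen] at hx
    rw [Finset.mem_coe, Finset.mem_filter, Finset.mem_range, ← ht, ← hd]
    exact ⟨by simpa using bitsToNat_lt (List.ofFn x), hx.2⟩
  · exact fun x _ y _ hxy => bitsToNat_ofFn_injective n hxy
  · intro N hN
    rw [Finset.mem_coe, Finset.mem_filter] at hN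
    have hmem : N ∈ (univ : Finset (Fin n → Bool)).image (fun x => bitsToNat (List.ofFn x)) := by
      rw [coprimePairs_image_val]; exact hN.1
    obtain ⟨x, -, rfl⟩ := Finset.mem_image.1 hmem
    refine ⟨x, ?_, rfl⟩
    rw [Finset.mem_coe, Finset.mem_filter]
    have hlen : (List.ofFn x).length = n := List.length_ofFn ..
    obtain ⟨ht, hd⟩ := coprimePairs_take_drop (List.ofFn x) (h := n / 2)
      (by rw [hlen]; exact Nat.div_le_self n 2)
    rw [hlen, ht, hd]
    exact ⟨Finset.mem_univ _, hN.2⟩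

/-- At most `K / p + 1` multiples of `p` lie in `[0, K)`. [folklore] -/
theorem coprimePairs_card_multiples_le (K p : ℕ) :
    ((range K).filter fun a => p ∣ a).card ≤ K / p + 1 := by
  calc ((range K).filter fun a => p ∣ a).card ≤ (range (K / p + 1)).card := by
        refine Finset.card_le_card_of_injOn (fun a => a / p) ?_ ?_
        · intro a ha
          rw [Finset.mem_coe, Finset.mem_filter, Finset.mem_range] at ha
          rw [Finset.mem_coe, Finset.mem_range]
          exact Nat.lt_succ_of_le (Nat.div_le_div_right ha.1.le)
        · intro a ha b hb hab
          rw [Finset.mem_coe, Finset.mem_filter] at ha hb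
          simp only at hab
          rw [← Nat.div_mul_cancel ha.2, ← Nat.div_mul_cancel hb.2, hab]
    _ = K / p + 1 := card_range _

/-- At least `K - ⌊K/3⌋ - 1` non-multiples of `p ≥ 3` lie in `[0, K)`. [folklore] -/
theorem coprimePairs_card_nondvd_ge (K p : ℕ) (hp : 3 ≤ p) :
    K - (K / 3 + 1) ≤ ((range K).filter fun a => ¬ p ∣ a).card := by
  have h1 := Finset.card_filter_add_card_filter_not (s := range K) (fun a => p ∣ a)
  rw [card_range] at h1
  have h2 := coprimePairs_card_multiples_le K p
  have h3 : K / p ≤ K / 3 := Nat.div_le_div_left hp (by norm_num)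
  omega

/-- Elementary Chebyshev bound in `ℕ`: `2^k ≤ k · π(2^k) + k + 1`
(`2^N ≤ (N+1) · lcm(1..N) ≤ (N+1) · N^{π(N)}` at `N = 2^k`). [folklore] -/
theorem coprimePairs_primesLE_two_pow (k : ℕ) :
    2 ^ k ≤ k * (Nat.primesLE (2 ^ k)).card + k + 1 := by
  have h1 := Chebyshev.two_pow_le_mul_lcmUpto (2 ^ k)
  have h2 : Nat.lcmUpto (2 ^ k) ≤ (2 ^ k) ^ (Nat.primesLE (2 ^ k)).card := by
    rw [Nat.lcmUpto_eq_prod_pow_log]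
    exact Finset.prod_le_pow_card _ _ _ fun p _ => Nat.pow_log_le_self p (by positivity)
  have h3 : 2 ^ k + 1 ≤ 2 ^ (k + 1) := by
    rw [pow_succ]; have := Nat.one_le_two_pow (n := k); omega
  have h4 : 2 ^ (2 ^ k) ≤ 2 ^ (k + 1 + k * (Nat.primesLE (2 ^ k)).card) := by
    calc 2 ^ (2 ^ k) ≤ (2 ^ k + 1) * Nat.lcmUpto (2 ^ k) := h1
      _ ≤ 2 ^ (k + 1) * (2 ^ k) ^ (Nat.primesLE (2 ^ k)).card := Nat.mul_le_mul h3 h2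
      _ = 2 ^ (k + 1 + k * (Nat.primesLE (2 ^ k)).card) := by rw [← pow_mul, ← pow_add]
  have := (Nat.pow_le_pow_iff_right (by norm_num : 1 < 2)).1 h4
  omega

/-- The good pairs inject: `#(odd primes ≤ 2^{h'+1}) · (2^h - ⌊2^h/3⌋ - 1) ≤ #{N < 2^{h+h'} |
(N mod 2^h | 2 (N / 2^h) + 1) ≠ 0}` via `(a, p) ↦ a + 2^h ⌊p/2⌋`. [folklore] -/
theorem coprimePairs_good_le (h h' : ℕ) :
    ((Nat.primesLE (2 ^ (h' + 1))).erase 2).card * (2 ^ h - (2 ^ h / 3 + 1)) ≤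
    ((range (2 ^ (h + h'))).filter fun N : ℕ =>
      jacobiSym ((N % 2 ^ h : ℕ) : ℤ) (2 * (N / 2 ^ h) + 1) ≠ 0).card := by
  set T : ℕ := 2 ^ h with hT
  set OP : Finset ℕ := (Nat.primesLE (2 ^ (h' + 1))).erase 2 with hOP
  have hTpos : 0 < T := by positivity
  -- membership in `OP`: an odd prime `p ≤ 2 · 2^h'`
  have hmemOP : ∀ p ∈ OP, p.Prime ∧ p % 2 = 1 ∧ p ≤ 2 * 2 ^ h' := by
    intro p hp
    rw [hOP, Finset.mem_erase, Nat.mem_primesLE] at hp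
    refine ⟨hp.2.2, ?_, by rw [← pow_succ']; exact hp.2.1⟩
    rcases hp.2.2.eq_two_or_odd with h2 | hodd
    · exact absurd h2 hp.1
    · exact hodd
  calc OP.card * (T - (T / 3 + 1)) = ∑ p ∈ OP, (T - (T / 3 + 1)) := by
        rw [Finset.sum_const, smul_eq_mul]
    _ ≤ ∑ p ∈ OP, ((range T).filter fun a => ¬ p ∣ a).card :=
        Finset.sum_le_sum fun p hp => coprimePairs_card_nondvd_ge T p (by
          obtain ⟨hpr, hodd, -⟩ := hmemOP p hp
          have := hpr.two_le
          omega)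
    _ = ((range T ×ˢ OP).filter fun q : ℕ × ℕ => ¬ q.2 ∣ q.1).card := by
        rw [Finset.card_filter, Finset.sum_product_right]
        simp only [Finset.card_filter]
    _ ≤ _ := by
        refine Finset.card_le_card_of_injOn (fun q : ℕ × ℕ => q.1 + T * (q.2 / 2)) ?_ ?_
        · intro q hq
          rw [Finset.mem_coe, Finset.mem_filter, Finset.mem_product, Finset.mem_range] at hq
          obtain ⟨⟨ha, hp⟩, hndvd⟩ := hq
          obtain ⟨hpr, hodd, hple⟩ := hmemOP q.2 hp
          have hmod : (q.1 + T * (q.2 / 2)) % T = q.1 := by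
            rw [Nat.add_mul_mod_self_left, Nat.mod_eq_of_lt ha]
          have hdiv : (q.1 + T * (q.2 / 2)) / T = q.2 / 2 := by
            rw [Nat.add_mul_div_left _ _ hTpos, Nat.div_eq_of_lt ha, zero_add]
          have hp2 : 2 * (q.2 / 2) + 1 = q.2 := by omega
          rw [Finset.mem_coe, Finset.mem_filter, Finset.mem_range, hmod, hdiv, hp2]
          refine ⟨?_, jacobiSym.ne_zero ?_⟩
          · have hlt : q.2 / 2 < 2 ^ h' := by omega
            calc q.1 + T * (q.2 / 2) < T + T * (q.2 / 2) := by omega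
              _ = T * (q.2 / 2 + 1) := by ring
              _ ≤ T * 2 ^ h' := Nat.mul_le_mul_left T hlt
              _ = 2 ^ (h + h') := by rw [hT, pow_add]
          · rw [Int.gcd_natCast_natCast]
            exact ((Nat.Prime.coprime_iff_not_dvd hpr).2 hndvd).symm
        · intro q hq q' hq' hqq'
          rw [Finset.mem_coe, Finset.mem_filter, Finset.mem_product, Finset.mem_range] at hq hq'
          obtain ⟨-, hodd, -⟩ := hmemOP q.2 hq.1.2
          obtain ⟨-, hodd', -⟩ := hmemOP q'.2 hq'.1.2
          simp only at hqq'
          have h1 : q.1 = q'.1 := by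
            have := congrArg (· % T) hqq'
            simpa only [Nat.add_mul_mod_self_left, Nat.mod_eq_of_lt hq.1.1,
              Nat.mod_eq_of_lt hq'.1.1] using this
          have h2 : q.2 / 2 = q'.2 / 2 := by
            have := congrArg (· / T) hqq'
            simpa only [Nat.add_mul_div_left _ _ hTpos, Nat.div_eq_of_lt hq.1.1,
              Nat.div_eq_of_lt hq'.1.1, zero_add] using this
          exact Prod.ext h1 (by omega)

/-- `4 (m + 1) + 2 ≤ 3 · 2^m` for `m ≥ 4`. [folklore] -/
theorem coprimePairs_exp {m : ℕ} (hm : 4 ≤ m) : 4 * (m + 1) + 2 ≤ 3 * 2 ^ m := by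
  induction m, hm using Nat.le_induction with
  | base => norm_num
  | succ m hm ih =>
    rw [pow_succ]
    omega

/-- The closing arithmetic: `T ≤ 2Q`, `2M ≤ K + 2k + 1`, `4k + 2 ≤ 3M` give `T M ≤ 4 Q K`. [folklore] -/
theorem coprimePairs_arith {T M Q K k : ℕ} (hq : T ≤ 2 * Q) (hK : 2 * M ≤ K + 2 * k + 1)
    (hx : 4 * k + 2 ≤ 3 * M) : T * M ≤ 4 * Q * K := by
  nlinarith [Nat.mul_le_mul_right K hq, Nat.mul_le_mul_right T hK, Nat.mul_le_mul_right T hx]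

/-- RUNG STUB R-A (`stub_coprimePairs_lower`): eventually `2ⁿ ≤ 4 n · #{x : Fin n → Bool | χ₂ x ≠ 0}`
(pairs `(u, v)` with `2v+1` an odd prime `≤ 2^{⌈n/2⌉+1}` not dividing `u` are
`≥ (2^{⌊n/2⌋} − ⌊2^{⌊n/2⌋}/3⌋ − 1) · (π(2^{⌈n/2⌉+1}) − 1)`; the prime count by the elementary Chebyshev
bound `2^N ≤ (N+1) · lcm(1..N)` of Mathlib). [folklore] -/
theorem stub_coprimePairs_lower : ∃ n₀ : ℕ, ∀ n ≥ n₀,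
    (2 : ℤ) ^ n ≤ 4 * (n : ℤ) * ((univ.filter fun x : Fin n → Bool =>
      jacobiSym (↑(bitsToNat ((List.ofFn x).take ((List.ofFn x).length / 2))))
        (2 * bitsToNat ((List.ofFn x).drop ((List.ofFn x).length / 2)) + 1) ≠ 0).card : ℤ) := by
  refine ⟨8, fun n hn => ?_⟩
  rw [coprimePairs_card_eq n]
  obtain ⟨h, h', hn', hn2, hh, hh'⟩ :
      ∃ h h' : ℕ, n = h + h' ∧ n / 2 = h ∧ 4 ≤ h ∧ 4 ≤ h' :=
    ⟨n / 2, n - n / 2, by omega, rfl, by omega, by omega⟩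
  rw [hn2]
  subst hn'
  -- the natural-number inequality
  have hgood := coprimePairs_good_le h h'
  have hprimes := coprimePairs_primesLE_two_pow (h' + 1)
  have herase : (Nat.primesLE (2 ^ (h' + 1))).card - 1 ≤
      ((Nat.primesLE (2 ^ (h' + 1))).erase 2).card := Finset.pred_card_le_card_erase
  set A := ((range (2 ^ (h + h'))).filter fun N : ℕ =>
      jacobiSym ((N % 2 ^ h : ℕ) : ℤ) (2 * (N / 2 ^ h) + 1) ≠ 0).card with hA
  set c := (Nat.primesLE (2 ^ (h' + 1))).card with hc
  set e := ((Nat.primesLE (2 ^ (h' + 1))).erase 2).card with he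
  set T : ℕ := 2 ^ h with hT
  set M : ℕ := 2 ^ h' with hM
  have hT16 : 16 ≤ T := by
    have := Nat.pow_le_pow_right (show 0 < 2 by norm_num) hh
    simpa [hT] using this
  have hq : T ≤ 2 * (T - (T / 3 + 1)) := by omega
  have h2M : 2 ^ (h' + 1) = 2 * M := by rw [hM, pow_succ']
  rw [h2M] at hprimes
  have hK : 2 * M ≤ (h' + 1) * e + 2 * (h' + 1) + 1 := by
    have := Nat.mul_le_mul_left (h' + 1) (show c ≤ e + 1 by omega)
    rw [Nat.mul_succ] at this
    omega
  have hx : 4 * (h' + 1) + 2 ≤ 3 * M := coprimePairs_exp hh'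
  have harith := coprimePairs_arith hq hK hx
  have hnat : 2 ^ (h + h') ≤ 4 * (h + h') * A := by
    calc 2 ^ (h + h') = T * M := by rw [hT, hM, pow_add]
      _ ≤ 4 * (T - (T / 3 + 1)) * ((h' + 1) * e) := harith
      _ = 4 * (h' + 1) * (e * (T - (T / 3 + 1))) := by ring
      _ ≤ 4 * (h' + 1) * A := Nat.mul_le_mul_left _ hgood
      _ ≤ 4 * (h + h') * A := Nat.mul_le_mul_right _ (by omega)
  exact_mod_cast hnat

end Summit.PneNP.PneNP.Theorems.CircuitNpAcc0
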